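import Mathlib.Algebra.CharP.Lemmas
import Mathlib.RingTheory.Filtration
import HarnessLib

/-!
# Powers of the level ideals `((1+T)^{p^m} − 1)` of an Iwasawa algebra lie in powers of the maximal ideal

Elementary commutative algebra, sorry-free. For a commutative ring `R`, a prime `p`, an ideal `I` with
`(p : R) ∈ I` and an element `x ∈ I`, the elements `ω_m := (1 + x) ^ (p ^ m) − 1` satisfy

* `one_add_pow_prime_sub_one_eq` — `(1 + x)^p − 1 = x · (x^{p−1} + p·s)` for some `s` (binomial theorem);
* `one_add_pow_prime_pow_sub_one_mem_pow` — `ω_m ∈ I ^ (m + 1)` (induction: `ω_{m+1} = (1 + ω_m)^p − 1`);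
* `span_one_add_pow_prime_pow_sub_one_le_pow` — `(ω_m) ≤ I ^ (m + 1)`;
* `one_add_pow_prime_pow_sub_one_dvd` / `span_one_add_pow_prime_pow_sub_one_antitone` — `ω_m ∣ ω_n` for
  `m ≤ n` (the level ideals decrease);
* `iInf_span_one_add_pow_prime_pow_sub_one_eq_bot` — over a Noetherian local ring with `x, p ∈ 𝔪`:
  `⨅_m (ω_m) = ⊥` (Krull's intersection theorem, Mathlib `Ideal.iInf_pow_eq_bot_of_isLocalRing`);
* `iInf_span_one_add_pow_prime_pow_sub_one_smul_eq_bot`, `eq_of_forall_sub_mem_levelIdeal_smul` — the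
  module form: for a finite module `M`, `⨅_m ω_m • M = ⊥`, so two elements congruent modulo `ω_m • M` for
  every `m` are EQUAL («an identity in a finitely generated `Λ`-module may be tested after every finite-level
  specialisation»).

Dictionary (nothing below depends on it): `Λ = ℤ_p⟦Γ⟧ ≅ ℤ_p⟦T⟧` with `1 + T = [γ]` for a topological generator
`γ`; the kernel of `Λ → ℤ_p[Γ/Γ^{p^m}]` is the principal ideal `([γ^{p^m}] − 1) = (ω_m)` [cite: Lang1990,
Ch. 5 §1–§2 (the modules `M/(γ^{p^n} − 1)M`, materialised copy p. 127)]; with `I = 𝔪 = (p, T)` the lemma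
`ω_m ∈ 𝔪^{m+1}` is the standard step behind «`⋂_r I_{0,r} = 0`», the testing-by-specialisation step of the
proof of [KLZ17] Thm 9.5.2 / Lemma 8.1.5 as used in the in-cell assembly `L-η`
(`pub/bsd-litref/cgs25/sheets/D-AUDIT-cgs25-r2-ADDENDUM-9.md` §3 Claim A′, ADDENDUM-11 §3). The statements are
elementary and carry the [cite:] locator of the printed step they serve; they are not theorems printed in the
sources.
-/

namespace Literature.NumberTheory.IwasawaTheory

open Ideal

section CommRing

variable {R : Type*} [CommRing R] {p : ℕ}

/-- Binomial step: `(1 + x)^p − 1 = x · (x^{p−1} + p·s)`. [cite: KingsLoefflerZerbes2015, §9.5, proof of Thm 9.5.2 (testing an identity in `𝐃(𝓕⁻H)` after `pr_{0,r}` for every `r`, arXiv v3 p. 84; cf. §8.1 proof of Lemma 8.1.5, p. 70) — elementary algebra behind «⋂_r I_{0,r} = 0» in the in-cell assembly L-η (D-AUDIT-cgs25-r2-ADDENDUM-9 §3 / ADDENDUM-11 §3); not a statement printed in the source] -/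
theorem one_add_pow_prime_sub_one_eq (hp : p.Prime) (x : R) :
    ∃ s : R, (1 + x) ^ p - 1 = x * (x ^ (p - 1) + p * s) := by
  obtain ⟨r, hr⟩ := exists_add_pow_prime_eq hp x 1
  refine ⟨r, ?_⟩
  have hp1 : p - 1 + 1 = p := Nat.sub_add_cancel hp.one_lt.le
  have hxp : x ^ p = x * x ^ (p - 1) := by
    rw [← pow_succ', hp1]
  rw [add_comm (1 : R) x, hr, one_pow, hxp]
  ring

/-- The level elements `ω_m = (1 + x)^{p^m} − 1` lie in `I^{m+1}` as soon as `x ∈ I` and `p ∈ I`.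
[cite: KingsLoefflerZerbes2015, §9.5, proof of Thm 9.5.2 (arXiv v3 p. 84) / §8.1 proof of Lemma 8.1.5 (p. 70) — the step «⋂_r I_{0,r}·(finitely generated) = 0» of the in-cell assembly L-η (ADDENDUM-9 §3 Claim A′; ADDENDUM-11 §3: `I_{0,r} ⊂ 𝔪^r`); elementary, not printed in the source] [cite: Lang1990, Ch. 5 §1 (`M/(γ^{p^n} − 1)M`, materialised p. 127)] -/
theorem one_add_pow_prime_pow_sub_one_mem_pow (hp : p.Prime) {I : Ideal R} {x : R} (hx : x ∈ I)
    (hpI : (p : R) ∈ I) (m : ℕ) : (1 + x) ^ p ^ m - 1 ∈ I ^ (m + 1) := by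
  induction m with
  | zero => simpa using hx
  | succ m ih =>
    set ω : R := (1 + x) ^ p ^ m - 1 with hω
    have h1 : (1 + x) ^ p ^ (m + 1) - 1 = (1 + ω) ^ p - 1 := by
      rw [hω, pow_succ, pow_mul]
      ring
    obtain ⟨s, hs⟩ := one_add_pow_prime_sub_one_eq hp ω
    rw [h1, hs, pow_succ]
    refine Ideal.mul_mem_mul ih (I.add_mem ?_ (I.mul_mem_right _ hpI))
    have hωI : ω ∈ I := Ideal.pow_le_self (Nat.succ_ne_zero m) ih
    have hp1 : 0 < p - 1 := by
      have := hp.two_le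
      omega
    exact I.pow_mem_of_mem hωI _ hp1

/-- Ideal form: `(ω_m) ≤ I^{m+1}`. [cite: KingsLoefflerZerbes2015, §9.5, proof of Thm 9.5.2 (arXiv v3 p. 84) — step «⋂_r I_{0,r} = 0» of the in-cell assembly L-η (ADDENDUM-9/11 §3); elementary, not printed in the source] -/
theorem span_one_add_pow_prime_pow_sub_one_le_pow (hp : p.Prime) {I : Ideal R} {x : R} (hx : x ∈ I)
    (hpI : (p : R) ∈ I) (m : ℕ) : Ideal.span {(1 + x) ^ p ^ m - 1} ≤ I ^ (m + 1) := by
  rw [Ideal.span_le, Set.singleton_subset_iff]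
  exact one_add_pow_prime_pow_sub_one_mem_pow hp hx hpI m

/-- The level elements divide each other along the tower: `ω_m ∣ ω_n` for `m ≤ n`.
[cite: Lang1990, Ch. 5 §1–§2 (the projections `M/(γ^{p^{n}} − 1)M → M/(γ^{p^m} − 1)M`, materialised p. 127–128)] [cite: KingsLoefflerZerbes2015, §9.5 (the inverse system `pr_{0,r}`, arXiv v3 p. 82–84) — bookkeeping of the in-cell assembly L-η; elementary] -/
theorem one_add_pow_prime_pow_sub_one_dvd (x : R) {m n : ℕ} (hmn : m ≤ n) :
    (1 + x) ^ p ^ m - 1 ∣ (1 + x) ^ p ^ n - 1 := by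
  obtain ⟨k, rfl⟩ := Nat.exists_eq_add_of_le hmn
  rw [pow_add, pow_mul]
  simpa using sub_dvd_pow_sub_pow ((1 + x) ^ p ^ m) 1 (p ^ k)

/-- The level ideals decrease: `(ω_n) ≤ (ω_m)` for `m ≤ n`. [cite: Lang1990, Ch. 5 §1–§2 (materialised p. 127–128)] [cite: KingsLoefflerZerbes2015, §9.5 (arXiv v3 p. 82–84) — bookkeeping of the in-cell assembly L-η; elementary] -/
theorem span_one_add_pow_prime_pow_sub_one_antitone (x : R) {m n : ℕ} (hmn : m ≤ n) :
    Ideal.span {(1 + x) ^ p ^ n - 1} ≤ Ideal.span {(1 + x) ^ p ^ m - 1} :=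
  Ideal.span_singleton_le_span_singleton.2 (one_add_pow_prime_pow_sub_one_dvd x hmn)

end CommRing

section Local

variable {R : Type*} [CommRing R] [IsNoetherianRing R] [IsLocalRing R] {p : ℕ}

/-- Over a Noetherian local ring with `x, p ∈ 𝔪`: `⨅_m (ω_m) = ⊥` (Krull's intersection theorem).
[cite: KingsLoefflerZerbes2015, §9.5, proof of Thm 9.5.2 (arXiv v3 p. 84) / §8.1 proof of Lemma 8.1.5 (p. 70) — the step «⋂_r I_{0,r} = 0» of the in-cell assembly L-η (ADDENDUM-9 §3 Claim A′, ADDENDUM-11 §3); elementary, not printed in the source] -/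
theorem iInf_span_one_add_pow_prime_pow_sub_one_eq_bot (hp : p.Prime) {x : R}
    (hx : x ∈ IsLocalRing.maximalIdeal R) (hpR : (p : R) ∈ IsLocalRing.maximalIdeal R) :
    ⨅ m : ℕ, Ideal.span {(1 + x) ^ p ^ m - 1} = ⊥ := by
  rw [eq_bot_iff]
  calc ⨅ m : ℕ, Ideal.span {(1 + x) ^ p ^ m - 1}
      ≤ ⨅ m : ℕ, IsLocalRing.maximalIdeal R ^ m :=
        le_iInf fun m => iInf_le_of_le m
          ((span_one_add_pow_prime_pow_sub_one_le_pow hp hx hpR m).trans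
            (Ideal.pow_le_pow_right (Nat.le_succ m)))
    _ = ⊥ := Ideal.iInf_pow_eq_bot_of_isLocalRing (I := IsLocalRing.maximalIdeal R)
          (IsLocalRing.maximalIdeal.isMaximal R).ne_top
    _ ≤ ⊥ := le_rfl

variable {M : Type*} [AddCommGroup M] [Module R M] [Module.Finite R M]

/-- Module form: for a finite module `M` over a Noetherian local ring with `x, p ∈ 𝔪`,
`⨅_m ω_m • M = ⊥`. [cite: KingsLoefflerZerbes2015, §9.5, proof of Thm 9.5.2 (arXiv v3 p. 84) — testing an identity of the in-cell assembly L-η in a finitely generated `Λ_D ⊗̂ Λ_Γ ⊗ 𝒪`-module after every `pr_{0,r}` (ADDENDUM-11 §3 Claim A′, the «Krull» alternative to freeness); elementary, not printed in the source] -/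
theorem iInf_span_one_add_pow_prime_pow_sub_one_smul_eq_bot (hp : p.Prime) {x : R}
    (hx : x ∈ IsLocalRing.maximalIdeal R) (hpR : (p : R) ∈ IsLocalRing.maximalIdeal R) :
    (⨅ m : ℕ, Ideal.span {(1 + x) ^ p ^ m - 1} • (⊤ : Submodule R M)) = ⊥ := by
  rw [eq_bot_iff]
  calc (⨅ m : ℕ, Ideal.span {(1 + x) ^ p ^ m - 1} • (⊤ : Submodule R M))
      ≤ ⨅ m : ℕ, IsLocalRing.maximalIdeal R ^ m • (⊤ : Submodule R M) :=
        le_iInf fun m => iInf_le_of_le m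
          (Submodule.smul_mono_left
            ((span_one_add_pow_prime_pow_sub_one_le_pow hp hx hpR m).trans
              (Ideal.pow_le_pow_right (Nat.le_succ m))))
    _ = ⊥ := Ideal.iInf_pow_smul_eq_bot_of_isLocalRing (I := IsLocalRing.maximalIdeal R) (M := M)
          (IsLocalRing.maximalIdeal.isMaximal R).ne_top
    _ ≤ ⊥ := le_rfl

/-- Testing by specialisation: two elements of a finite module over a Noetherian local ring that are congruent
modulo `ω_m • M` for every level `m` are equal. [cite: KingsLoefflerZerbes2015, §9.5, proof of Thm 9.5.2 (arXiv v3 p. 84: the two maps «agree» once they agree after every `pr_{k,r}`) — the testing step of Claim A′ of the in-cell assembly L-η (ADDENDUM-9/11 §3); elementary, not printed in the source] -/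
theorem eq_of_forall_sub_mem_levelIdeal_smul (hp : p.Prime) {x : R}
    (hx : x ∈ IsLocalRing.maximalIdeal R) (hpR : (p : R) ∈ IsLocalRing.maximalIdeal R) {y z : M}
    (h : ∀ m : ℕ, y - z ∈ Ideal.span {(1 + x) ^ p ^ m - 1} • (⊤ : Submodule R M)) : y = z := by
  have hyz : y - z ∈ (⨅ m : ℕ, Ideal.span {(1 + x) ^ p ^ m - 1} • (⊤ : Submodule R M)) :=
    (Submodule.mem_iInf _).2 h
  rw [iInf_span_one_add_pow_prime_pow_sub_one_smul_eq_bot hp hx hpR, Submodule.mem_bot,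
    sub_eq_zero] at hyz
  exact hyz

end Local

end Literature.NumberTheory.IwasawaTheory
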